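import Summits.QuantumFields.YangMills.Theorems.ColdStartUniversalityLatticeLangevinLiebRobinsonSemigroup
import Summits.QuantumFields.YangMills.Theorems.ColdStartUniversalityLatticeLangevinLiebRobinsonTorusGeometry
import HarnessLib

/-!
# Route `ColdStartUniversality` (fixed-cut-off SZZ dynamics; LIEB–ROBINSON / LOCALITY package, file 11):
# ★★★ THE LIGHT CONE OF THE SZZ SEMIGROUP — explicit finite speed of propagation at EVERY coupling, every volume

Helper file (seat `ym-line-csu-p1`, g30; `--supports stmt-QuantumFields-24809`).  The weighted Lieb–Robinson bound of
`…LiebRobinsonSemigroup` (`transitionKernel_liebRobinson`) specialised to the exponential torus weights `108^D` of `…LiebRobinsonTorusGeometry`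
(`D` = cyclic sup-distance of the base sites on `(ℤ/L)³`), in directly quotable form, for the `SU(2)` SZZ Langevin dynamics at ANY coupling `β'`
(no small-coupling window here), with `λ = |β'|(4+4√2+12·108) = (1300+4√2)|β'|`:
* ★★ `transitionKernel_linkLipschitz_profile` — the semigroup propagates link-Lipschitz profiles with exponential spatial tails: if `F` is
  continuous with profile `ℓ` then `κ_t F` is Lipschitz in the link `e₀` with constant `e^(λt)·Σ_e ℓ_e·108^(−D(e,e₀))`;
* ★★★ `transitionKernel_lightCone` — if `ℓ` is supported in `Λ` and two starts `y, y'` AGREE on every link within sup-distance `R` of `Λ`, then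
  `|κ_t F(y) − κ_t F(y')| ≤ 12√2·e^(λt)·2^(−(R+1))·Σ_e ℓ_e`: what the start looks like outside the ball of radius `R` around the support of `F`
  is invisible up to an error `e^(λt − (R+1)log 2)` — a light cone of slope `λ/log 2` links per unit lattice time, uniformly in the volume `L`;
* ★★ `transitionKernel_lightCone_le` — the `δ`-form: the error is `≤ δ` as soon as `(R+1)·log 2 ≥ λt + log(12√2·Σℓ/δ)`;
* ★★★ `solution_lightCone` — the same for two strong solutions (on possibly different filtered probability spaces) started at `y`, `y'`.
THEOREMS ONLY, no definition, no sorry; [folklore] (Lieb–Robinson-type bounds for classical lattice dynamics).  HONEST FRAMING: fixed cut-off;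
valid at every `β'` but the slope `λ ∝ |β'|` — in the route's scaling `β'_K = (γε_K)⁻¹/2 → ∞` (physical time `s = ε_K t`) the cone gives NO
`K`-uniform locality in physical units; `UniformColdStartMixing` (24809) is NOT restated; no crux, rung or summit statement is proved; the
Yang–Mills mass gap is NOT proved.
-/

set_option autoImplicit false

noncomputable section

namespace Summit.QuantumFields.YangMills.Theorems.ColdStartUniversality.LiebRobinson

open MeasureTheory ProbabilityTheory Matrix Complex Finset Filter Set Metric
open scoped ComplexConjugate BigOperators Matrix NNReal ENNReal Topology
open Literature.Probability.Process Literature.MathematicalPhysics.QuantumFieldTheory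
open Literature.MathematicalPhysics.QuantumFieldTheory.Balaban1983to89
open Literature.MathematicalPhysics.QuantumLattice (fundamentalRep fundamentalLatticeRep continuous_fundamentalRep fundamentalRep_apply)

variable {L : ℕ} [NeZero L]

/-! ## §1. Propagation of link-Lipschitz profiles -/

/-- ★★ **The SZZ semigroup propagates link-Lipschitz profiles with exponential spatial tails** (every coupling `β'`, every volume).  If
`F` is continuous and `ℓ_e`-Lipschitz in each link `e` (Frobenius distance, other links frozen), then for every Markov kernel family `κ`
realising the SZZ transition laws, every `t`, every link `e₀` and all starts `y, y'` differing only at `e₀`: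
`|κ_t F(y) − κ_t F(y')| ≤ e^(λt)·(Σ_e ℓ_e·108^(−D(e,e₀)))·‖y_(e₀) − y'_(e₀)‖_F`, `λ = |β'|(4+4√2+12·108)`, `D` the cyclic sup-distance of
the base sites (`transitionKernel_liebRobinson` with the admissible weight `108^(D(·,e₀))`). [folklore] -/
theorem transitionKernel_linkLipschitz_profile (L : ℕ) [NeZero L] (β' : ℝ)
    (κ : ℝ≥0 → Kernel (GaugeConfig 3 L (Matrix.specialUnitaryGroup (Fin 2) ℂ))
      (GaugeConfig 3 L (Matrix.specialUnitaryGroup (Fin 2) ℂ))) [∀ t, IsMarkovKernel (κ t)]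
    (hreal : ∀ (t : ℝ≥0) (x : GaugeConfig 3 L (Matrix.specialUnitaryGroup (Fin 2) ℂ))
        (Ω : Type) [MeasurableSpace Ω] (P : Measure Ω) [IsProbabilityMeasure P]
        (W : ℝ≥0 → Ω → (Edge 3 L × NoiseIdx 2 → ℝ)) (hW : IsFlatBrownian W P)
        (U : ℝ≥0 → Ω → GaugeConfig 3 L (Matrix.specialUnitaryGroup (Fin 2) ℂ)),
        (∀ ω, U 0 ω = x) →
        (latticeLangevinDynamics (fundamentalLatticeRep 2) β').IsSolution (fundamentalRep (Fin 2))
          hW.natFiltration P W U →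
        κ t x = P.map (U t))
    {F : (GaugeConfig 3 L (Matrix.specialUnitaryGroup (Fin 2) ℂ)) → ℝ} (hFc : Continuous F) {ℓ : Edge 3 L → ℝ} (hℓ : ∀ e, 0 ≤ ℓ e)
    (hF : ∀ (e : Edge 3 L) (y y' : (GaugeConfig 3 L (Matrix.specialUnitaryGroup (Fin 2) ℂ))), (∀ f, f ≠ e → y f = y' f) →
      |F y - F y'| ≤ ℓ e * frobNorm ((y e : Matrix (Fin 2) (Fin 2) ℂ) - (y' e : Matrix (Fin 2) (Fin 2) ℂ)))
    (t : ℝ≥0) (e₀ : Edge 3 L) (y y' : (GaugeConfig 3 L (Matrix.specialUnitaryGroup (Fin 2) ℂ))) (hyy' : ∀ e, e ≠ e₀ → y e = y' e) :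
    |∫ z, F z ∂(κ t y) - ∫ z, F z ∂(κ t y')| ≤
      Real.exp ((|β'| * (4 + 4 * Real.sqrt 2 + 12 * 108)) * (t : ℝ)) * (∑ e : Edge 3 L, ℓ e * ((108 : ℝ)⁻¹) ^ (Finset.univ.sup fun i : Fin 3 => ((e.1 i - e₀.1 i).valMinAbs).natAbs)) *
        frobNorm ((y e₀ : Matrix (Fin 2) (Fin 2) ℂ) - (y' e₀ : Matrix (Fin 2) (Fin 2) ℂ)) := by
  classical
  set w : Edge 3 L → ℝ := fun e => (108 : ℝ) ^ (Finset.univ.sup fun i : Fin 3 => ((e.1 i - e₀.1 i).valMinAbs).natAbs) with hw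
  have hwpos : ∀ e, 0 < w e := fun e => by rw [hw]; positivity
  have hwadm := weight_pow_torusDist_admissible (L := L) e₀.1 (K := (108 : ℝ)) (by norm_num)
  have hLR := transitionKernel_liebRobinson L β' κ hreal w hwpos 108 (by norm_num) (fun e j hj => hwadm e j hj) hFc ℓ hℓ hF t y y'
  have hsum : ∑ f' : Edge 3 L, w f' * frobNorm ((y f' : Matrix (Fin 2) (Fin 2) ℂ) - (y' f' : Matrix (Fin 2) (Fin 2) ℂ)) = frobNorm ((y e₀ : Matrix (Fin 2) (Fin 2) ℂ) - (y' e₀ : Matrix (Fin 2) (Fin 2) ℂ)) := by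
    rw [Finset.sum_eq_single e₀]
    · have hw0 : w e₀ = 1 := by rw [hw]; simp only [torusDist_self, pow_zero]
      rw [hw0, one_mul]
    · intro f' _ hf'
      rw [hyy' f' hf', sub_self, frobNorm_zero, mul_zero]
    · intro h; exact absurd (Finset.mem_univ _) h
  have hratio : ∑ e : Edge 3 L, ℓ e / w e = ∑ e : Edge 3 L, ℓ e * ((108 : ℝ)⁻¹) ^ (Finset.univ.sup fun i : Fin 3 => ((e.1 i - e₀.1 i).valMinAbs).natAbs) := by
    refine Finset.sum_congr rfl fun e _ => ?_
    rw [hw, inv_pow, div_eq_mul_inv]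
  rw [hsum, hratio] at hLR
  exact hLR

/-! ## §2. The light cone -/

/-- ★★★ **The light cone of the SZZ semigroup** (every coupling `β'`, every volume `L`).  Let `F` be continuous with a link-Lipschitz
profile `ℓ ≥ 0` supported in the finite set of links `Λ`, and let the starts `y, y'` AGREE on every link whose base site is within cyclic
sup-distance `R` of the base site of some link of `Λ`.  Then for every realising kernel family and every `t`:
`|κ_t F(y) − κ_t F(y')| ≤ 12√2·e^(λt)·2^(−(R+1))·Σ_e ℓ_e`, `λ = |β'|(4+4√2+12·108)`.
Proof: telescoping over the links outside the ball with the propagated profile (`transitionKernel_linkLipschitz_profile`), `‖y_e − y'_e‖_F ≤ 2√2`,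
`108^(−D) ≤ 2^(−(R+1))·54^(−D)` for `D ≥ R+1`, and the volume-free sum `Σ_f 54^(−D(e,f)) ≤ 6` (`sum_edge_pow_torusDist_le`). [folklore] -/
theorem transitionKernel_lightCone (L : ℕ) [NeZero L] (β' : ℝ)
    (κ : ℝ≥0 → Kernel (GaugeConfig 3 L (Matrix.specialUnitaryGroup (Fin 2) ℂ))
      (GaugeConfig 3 L (Matrix.specialUnitaryGroup (Fin 2) ℂ))) [∀ t, IsMarkovKernel (κ t)]
    (hreal : ∀ (t : ℝ≥0) (x : GaugeConfig 3 L (Matrix.specialUnitaryGroup (Fin 2) ℂ))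
        (Ω : Type) [MeasurableSpace Ω] (P : Measure Ω) [IsProbabilityMeasure P]
        (W : ℝ≥0 → Ω → (Edge 3 L × NoiseIdx 2 → ℝ)) (hW : IsFlatBrownian W P)
        (U : ℝ≥0 → Ω → GaugeConfig 3 L (Matrix.specialUnitaryGroup (Fin 2) ℂ)),
        (∀ ω, U 0 ω = x) →
        (latticeLangevinDynamics (fundamentalLatticeRep 2) β').IsSolution (fundamentalRep (Fin 2))
          hW.natFiltration P W U →
        κ t x = P.map (U t))
    {F : (GaugeConfig 3 L (Matrix.specialUnitaryGroup (Fin 2) ℂ)) → ℝ} (hFc : Continuous F) {ℓ : Edge 3 L → ℝ} (hℓ : ∀ e, 0 ≤ ℓ e)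
    (hF : ∀ (e : Edge 3 L) (y y' : (GaugeConfig 3 L (Matrix.specialUnitaryGroup (Fin 2) ℂ))), (∀ f, f ≠ e → y f = y' f) →
      |F y - F y'| ≤ ℓ e * frobNorm ((y e : Matrix (Fin 2) (Fin 2) ℂ) - (y' e : Matrix (Fin 2) (Fin 2) ℂ)))
    (Λ : Finset (Edge 3 L)) (hℓΛ : ∀ e, e ∉ Λ → ℓ e = 0) (t : ℝ≥0) (R : ℕ) (y y' : (GaugeConfig 3 L (Matrix.specialUnitaryGroup (Fin 2) ℂ)))
    (hyy' : ∀ e₀ : Edge 3 L, (∃ e ∈ Λ, (Finset.univ.sup fun i : Fin 3 => ((e.1 i - e₀.1 i).valMinAbs).natAbs) ≤ R) → y e₀ = y' e₀) :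
    |∫ z, F z ∂(κ t y) - ∫ z, F z ∂(κ t y')| ≤
      12 * Real.sqrt 2 * Real.exp ((|β'| * (4 + 4 * Real.sqrt 2 + 12 * 108)) * (t : ℝ)) * ((2 : ℝ)⁻¹) ^ (R + 1) * ∑ e : Edge 3 L, ℓ e := by
  classical
  set A : ℝ := Real.exp ((|β'| * (4 + 4 * Real.sqrt 2 + 12 * 108)) * (t : ℝ)) with hA
  have hA0 : 0 ≤ A := (Real.exp_pos _).le
  set ℓ' : Edge 3 L → ℝ := fun e₀ => A * ∑ e : Edge 3 L, ℓ e * ((108 : ℝ)⁻¹) ^ (Finset.univ.sup fun i : Fin 3 => ((e.1 i - e₀.1 i).valMinAbs).natAbs) with hℓ'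
  have hℓ'0 : ∀ e₀, 0 ≤ ℓ' e₀ := fun e₀ => by
    rw [hℓ']; exact mul_nonneg hA0 (Finset.sum_nonneg fun e _ => mul_nonneg (hℓ e) (by positivity))
  have hprof : ∀ (e₀ : Edge 3 L) (z z' : (GaugeConfig 3 L (Matrix.specialUnitaryGroup (Fin 2) ℂ))), (∀ e, e ≠ e₀ → z e = z' e) →
      |(∫ u, F u ∂(κ t z)) - ∫ u, F u ∂(κ t z')| ≤ ℓ' e₀ * frobNorm ((z e₀ : Matrix (Fin 2) (Fin 2) ℂ) - (z' e₀ : Matrix (Fin 2) (Fin 2) ℂ)) :=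
    fun e₀ z z' hzz' => transitionKernel_linkLipschitz_profile L β' κ hreal hFc hℓ hF t e₀ z z' hzz'
  have htel := abs_sub_le_sum_linkLipschitz (F := fun z : (GaugeConfig 3 L (Matrix.specialUnitaryGroup (Fin 2) ℂ)) => ∫ u, F u ∂(κ t z)) ℓ' hprof y y'
  -- each link outside the ball contributes `2√2·A·2^(−(R+1))·Σ_e ℓ_e 54^(−D(e,e₀))`; links inside contribute nothing
  have hterm : ∀ e₀ : Edge 3 L, ℓ' e₀ * frobNorm ((y e₀ : Matrix (Fin 2) (Fin 2) ℂ) - (y' e₀ : Matrix (Fin 2) (Fin 2) ℂ)) ≤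
      2 * Real.sqrt 2 * A * ((2 : ℝ)⁻¹) ^ (R + 1) * ∑ e : Edge 3 L, ℓ e * ((54 : ℝ)⁻¹) ^ (Finset.univ.sup fun i : Fin 3 => ((e.1 i - e₀.1 i).valMinAbs).natAbs) := by
    intro e₀
    have hrhs : 0 ≤ 2 * Real.sqrt 2 * A * ((2 : ℝ)⁻¹) ^ (R + 1) * ∑ e : Edge 3 L, ℓ e * ((54 : ℝ)⁻¹) ^ (Finset.univ.sup fun i : Fin 3 => ((e.1 i - e₀.1 i).valMinAbs).natAbs) :=
      mul_nonneg (by positivity) (Finset.sum_nonneg fun e _ => mul_nonneg (hℓ e) (by positivity))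
    by_cases hin : ∃ e ∈ Λ, (Finset.univ.sup fun i : Fin 3 => ((e.1 i - e₀.1 i).valMinAbs).natAbs) ≤ R
    · rw [hyy' e₀ hin, sub_self, frobNorm_zero, mul_zero]; exact hrhs
    · push Not at hin
      have hd : frobNorm ((y e₀ : Matrix (Fin 2) (Fin 2) ℂ) - (y' e₀ : Matrix (Fin 2) (Fin 2) ℂ)) ≤ 2 * Real.sqrt 2 := by
        have h2 := frobNorm_sub_le_of_mem_unitaryGroup (Matrix.specialUnitaryGroup_le_unitaryGroup (y e₀).2)
          (Matrix.specialUnitaryGroup_le_unitaryGroup (y' e₀).2)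
        rw [Fintype.card_fin] at h2
        exact_mod_cast h2
      have hsum : ∑ e : Edge 3 L, ℓ e * ((108 : ℝ)⁻¹) ^ (Finset.univ.sup fun i : Fin 3 => ((e.1 i - e₀.1 i).valMinAbs).natAbs) ≤
          ((2 : ℝ)⁻¹) ^ (R + 1) * ∑ e : Edge 3 L, ℓ e * ((54 : ℝ)⁻¹) ^ (Finset.univ.sup fun i : Fin 3 => ((e.1 i - e₀.1 i).valMinAbs).natAbs) := by
        rw [Finset.mul_sum]
        refine Finset.sum_le_sum fun e _ => ?_
        by_cases he : e ∈ Λ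
        · have hR : R + 1 ≤ (Finset.univ.sup fun i : Fin 3 => ((e.1 i - e₀.1 i).valMinAbs).natAbs) := Nat.succ_le_of_lt (hin e he)
          have h108 : ((108 : ℝ)⁻¹) ^ (Finset.univ.sup fun i : Fin 3 => ((e.1 i - e₀.1 i).valMinAbs).natAbs) = ((2 : ℝ)⁻¹) ^ (Finset.univ.sup fun i : Fin 3 => ((e.1 i - e₀.1 i).valMinAbs).natAbs) * ((54 : ℝ)⁻¹) ^ (Finset.univ.sup fun i : Fin 3 => ((e.1 i - e₀.1 i).valMinAbs).natAbs) := by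
            rw [← mul_pow]; norm_num
          have h2 : ((2 : ℝ)⁻¹) ^ (Finset.univ.sup fun i : Fin 3 => ((e.1 i - e₀.1 i).valMinAbs).natAbs) ≤ ((2 : ℝ)⁻¹) ^ (R + 1) := pow_le_pow_of_le_one (by norm_num) (by norm_num) hR
          rw [h108]
          calc ℓ e * (((2 : ℝ)⁻¹) ^ (Finset.univ.sup fun i : Fin 3 => ((e.1 i - e₀.1 i).valMinAbs).natAbs) * ((54 : ℝ)⁻¹) ^ (Finset.univ.sup fun i : Fin 3 => ((e.1 i - e₀.1 i).valMinAbs).natAbs))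
              ≤ ℓ e * (((2 : ℝ)⁻¹) ^ (R + 1) * ((54 : ℝ)⁻¹) ^ (Finset.univ.sup fun i : Fin 3 => ((e.1 i - e₀.1 i).valMinAbs).natAbs)) :=
                mul_le_mul_of_nonneg_left (mul_le_mul_of_nonneg_right h2 (by positivity)) (hℓ e)
            _ = ((2 : ℝ)⁻¹) ^ (R + 1) * (ℓ e * ((54 : ℝ)⁻¹) ^ (Finset.univ.sup fun i : Fin 3 => ((e.1 i - e₀.1 i).valMinAbs).natAbs)) := by ring
        · rw [hℓΛ e he, zero_mul, zero_mul, mul_zero]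
      calc ℓ' e₀ * frobNorm ((y e₀ : Matrix (Fin 2) (Fin 2) ℂ) - (y' e₀ : Matrix (Fin 2) (Fin 2) ℂ)) ≤ ℓ' e₀ * (2 * Real.sqrt 2) := mul_le_mul_of_nonneg_left hd (hℓ'0 e₀)
        _ = 2 * Real.sqrt 2 * A * ∑ e : Edge 3 L, ℓ e * ((108 : ℝ)⁻¹) ^ (Finset.univ.sup fun i : Fin 3 => ((e.1 i - e₀.1 i).valMinAbs).natAbs) := by rw [hℓ']; ring
        _ ≤ 2 * Real.sqrt 2 * A * (((2 : ℝ)⁻¹) ^ (R + 1) * ∑ e : Edge 3 L, ℓ e * ((54 : ℝ)⁻¹) ^ (Finset.univ.sup fun i : Fin 3 => ((e.1 i - e₀.1 i).valMinAbs).natAbs)) :=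
            mul_le_mul_of_nonneg_left hsum (by positivity)
        _ = _ := by ring
  -- the volume-free geometric sum, after swapping the order of summation
  have hgeo : ∀ e : Edge 3 L, ∑ e₀ : Edge 3 L, ((54 : ℝ)⁻¹) ^ (Finset.univ.sup fun i : Fin 3 => ((e.1 i - e₀.1 i).valMinAbs).natAbs) ≤ 6 := by
    intro e
    calc ∑ e₀ : Edge 3 L, ((54 : ℝ)⁻¹) ^ (Finset.univ.sup fun i : Fin 3 => ((e.1 i - e₀.1 i).valMinAbs).natAbs)
        = ∑ e₀ : Edge 3 L, ((54 : ℝ)⁻¹) ^ (Finset.univ.sup fun i : Fin 3 => ((e₀.1 i - e.1 i).valMinAbs).natAbs) := Finset.sum_congr rfl fun e₀ _ => by rw [torusDist_comm]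
      _ ≤ 6 := sum_edge_pow_torusDist_le (L := L) e.1
  calc |∫ z, F z ∂(κ t y) - ∫ z, F z ∂(κ t y')|
      ≤ ∑ e₀ : Edge 3 L, ℓ' e₀ * frobNorm ((y e₀ : Matrix (Fin 2) (Fin 2) ℂ) - (y' e₀ : Matrix (Fin 2) (Fin 2) ℂ)) := htel
    _ ≤ ∑ e₀ : Edge 3 L, 2 * Real.sqrt 2 * A * ((2 : ℝ)⁻¹) ^ (R + 1) * ∑ e : Edge 3 L, ℓ e * ((54 : ℝ)⁻¹) ^ (Finset.univ.sup fun i : Fin 3 => ((e.1 i - e₀.1 i).valMinAbs).natAbs) :=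
        Finset.sum_le_sum fun e₀ _ => hterm e₀
    _ = 2 * Real.sqrt 2 * A * ((2 : ℝ)⁻¹) ^ (R + 1) * ∑ e : Edge 3 L, ℓ e * ∑ e₀ : Edge 3 L, ((54 : ℝ)⁻¹) ^ (Finset.univ.sup fun i : Fin 3 => ((e.1 i - e₀.1 i).valMinAbs).natAbs) := by
        rw [← Finset.mul_sum, Finset.sum_comm]
        congr 1
        exact Finset.sum_congr rfl fun e _ => by rw [Finset.mul_sum]
    _ ≤ 2 * Real.sqrt 2 * A * ((2 : ℝ)⁻¹) ^ (R + 1) * ∑ e : Edge 3 L, ℓ e * 6 := by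
        refine mul_le_mul_of_nonneg_left (Finset.sum_le_sum fun e _ => mul_le_mul_of_nonneg_left (hgeo e) (hℓ e)) (by positivity)
    _ = 12 * Real.sqrt 2 * Real.exp ((|β'| * (4 + 4 * Real.sqrt 2 + 12 * 108)) * (t : ℝ)) * ((2 : ℝ)⁻¹) ^ (R + 1) * ∑ e : Edge 3 L, ℓ e := by
        rw [← Finset.sum_mul, hA]; ring

/-- ★★ **`δ`-form of the light cone.**  With `C = 12√2·Σ_e ℓ_e`: if `(R+1)·log 2 ≥ λt + log(C/δ)` then `|κ_t F(y) − κ_t F(y')| ≤ δ` for all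
starts agreeing on the `R`-ball around the support — i.e. at lattice time `t` the start is felt only within `≈ (λt + log(C/δ))/log 2` links of
the support of `F`, in every volume. [folklore] -/
theorem transitionKernel_lightCone_le (L : ℕ) [NeZero L] (β' : ℝ)
    (κ : ℝ≥0 → Kernel (GaugeConfig 3 L (Matrix.specialUnitaryGroup (Fin 2) ℂ))
      (GaugeConfig 3 L (Matrix.specialUnitaryGroup (Fin 2) ℂ))) [∀ t, IsMarkovKernel (κ t)]
    (hreal : ∀ (t : ℝ≥0) (x : GaugeConfig 3 L (Matrix.specialUnitaryGroup (Fin 2) ℂ))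
        (Ω : Type) [MeasurableSpace Ω] (P : Measure Ω) [IsProbabilityMeasure P]
        (W : ℝ≥0 → Ω → (Edge 3 L × NoiseIdx 2 → ℝ)) (hW : IsFlatBrownian W P)
        (U : ℝ≥0 → Ω → GaugeConfig 3 L (Matrix.specialUnitaryGroup (Fin 2) ℂ)),
        (∀ ω, U 0 ω = x) →
        (latticeLangevinDynamics (fundamentalLatticeRep 2) β').IsSolution (fundamentalRep (Fin 2))
          hW.natFiltration P W U →
        κ t x = P.map (U t))
    {F : (GaugeConfig 3 L (Matrix.specialUnitaryGroup (Fin 2) ℂ)) → ℝ} (hFc : Continuous F) {ℓ : Edge 3 L → ℝ} (hℓ : ∀ e, 0 ≤ ℓ e)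
    (hF : ∀ (e : Edge 3 L) (y y' : (GaugeConfig 3 L (Matrix.specialUnitaryGroup (Fin 2) ℂ))), (∀ f, f ≠ e → y f = y' f) →
      |F y - F y'| ≤ ℓ e * frobNorm ((y e : Matrix (Fin 2) (Fin 2) ℂ) - (y' e : Matrix (Fin 2) (Fin 2) ℂ)))
    (Λ : Finset (Edge 3 L)) (hℓΛ : ∀ e, e ∉ Λ → ℓ e = 0) (t : ℝ≥0) (R : ℕ) {δ : ℝ} (hδ : 0 < δ)
    (hR : (|β'| * (4 + 4 * Real.sqrt 2 + 12 * 108)) * (t : ℝ) + Real.log (12 * Real.sqrt 2 * (∑ e : Edge 3 L, ℓ e) / δ) ≤ ((R : ℝ) + 1) * Real.log 2)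
    (y y' : (GaugeConfig 3 L (Matrix.specialUnitaryGroup (Fin 2) ℂ))) (hyy' : ∀ e₀ : Edge 3 L, (∃ e ∈ Λ, (Finset.univ.sup fun i : Fin 3 => ((e.1 i - e₀.1 i).valMinAbs).natAbs) ≤ R) → y e₀ = y' e₀) :
    |∫ z, F z ∂(κ t y) - ∫ z, F z ∂(κ t y')| ≤ δ := by
  have h := transitionKernel_lightCone L β' κ hreal hFc hℓ hF Λ hℓΛ t R y y' hyy'
  refine h.trans ?_
  set C : ℝ := 12 * Real.sqrt 2 * ∑ e : Edge 3 L, ℓ e with hC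
  have hC0 : 0 ≤ C := by rw [hC]; exact mul_nonneg (by positivity) (Finset.sum_nonneg fun e _ => hℓ e)
  have hpow : ((2 : ℝ)⁻¹) ^ (R + 1) = Real.exp (-(((R : ℝ) + 1) * Real.log 2)) := by
    rw [Real.exp_neg, show ((R : ℝ) + 1) = ((R + 1 : ℕ) : ℝ) by push_cast; ring, Real.exp_nat_mul,
      Real.exp_log (by norm_num : (0 : ℝ) < 2), inv_pow]
  have hre : 12 * Real.sqrt 2 * Real.exp ((|β'| * (4 + 4 * Real.sqrt 2 + 12 * 108)) * (t : ℝ)) * ((2 : ℝ)⁻¹) ^ (R + 1) * ∑ e : Edge 3 L, ℓ e =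
      C * Real.exp ((|β'| * (4 + 4 * Real.sqrt 2 + 12 * 108)) * (t : ℝ) - ((R : ℝ) + 1) * Real.log 2) := by
    rw [hpow, sub_eq_add_neg, Real.exp_add, hC]; ring
  rw [hre]
  rcases eq_or_lt_of_le hC0 with hC00 | hCpos
  · rw [← hC00, zero_mul]; exact hδ.le
  · have h1 : (|β'| * (4 + 4 * Real.sqrt 2 + 12 * 108)) * (t : ℝ) - ((R : ℝ) + 1) * Real.log 2 ≤ -Real.log (C / δ) := by linarith
    have h2 : Real.exp ((|β'| * (4 + 4 * Real.sqrt 2 + 12 * 108)) * (t : ℝ) - ((R : ℝ) + 1) * Real.log 2) ≤ δ / C := by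
      have := Real.exp_le_exp.2 h1
      rwa [Real.exp_neg, Real.exp_log (div_pos hCpos hδ), inv_div] at this
    calc C * Real.exp ((|β'| * (4 + 4 * Real.sqrt 2 + 12 * 108)) * (t : ℝ) - ((R : ℝ) + 1) * Real.log 2) ≤ C * (δ / C) := mul_le_mul_of_nonneg_left h2 hC0
      _ = δ := mul_div_cancel₀ δ hCpos.ne'

/-! ## §3. Along strong solutions -/

/-- ★★★ **The light cone along strong SZZ solutions** (every coupling, every volume): two strong solutions `U`, `U'` of the `SU(2)` SZZ
Langevin SDE at coupling `β'` — on possibly different filtered probability spaces with flat Brownian drivers — started at deterministic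
configurations `y`, `y'` that agree on every link within sup-distance `R` of the support `Λ` of the profile of a continuous observable `F`
satisfy `|E[F(U_t)] − E'[F(U'_t)]| ≤ 12√2·e^(λt)·2^(−(R+1))·Σ_e ℓ_e`. [folklore] -/
theorem solution_lightCone (L : ℕ) [NeZero L] (β' : ℝ) (t : ℝ≥0)
    {F : (GaugeConfig 3 L (Matrix.specialUnitaryGroup (Fin 2) ℂ)) → ℝ} (hFc : Continuous F) {ℓ : Edge 3 L → ℝ} (hℓ : ∀ e, 0 ≤ ℓ e)
    (hF : ∀ (e : Edge 3 L) (y y' : (GaugeConfig 3 L (Matrix.specialUnitaryGroup (Fin 2) ℂ))), (∀ f, f ≠ e → y f = y' f) →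
      |F y - F y'| ≤ ℓ e * frobNorm ((y e : Matrix (Fin 2) (Fin 2) ℂ) - (y' e : Matrix (Fin 2) (Fin 2) ℂ)))
    (Λ : Finset (Edge 3 L)) (hℓΛ : ∀ e, e ∉ Λ → ℓ e = 0) (R : ℕ) (y y' : (GaugeConfig 3 L (Matrix.specialUnitaryGroup (Fin 2) ℂ)))
    (hyy' : ∀ e₀ : Edge 3 L, (∃ e ∈ Λ, (Finset.univ.sup fun i : Fin 3 => ((e.1 i - e₀.1 i).valMinAbs).natAbs) ≤ R) → y e₀ = y' e₀)
    (Ω : Type) [MeasurableSpace Ω] (P : Measure Ω) [IsProbabilityMeasure P]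
    (W : ℝ≥0 → Ω → (Edge 3 L × NoiseIdx 2 → ℝ)) (hW : IsFlatBrownian W P)
    (U : ℝ≥0 → Ω → (GaugeConfig 3 L (Matrix.specialUnitaryGroup (Fin 2) ℂ))) (hU0 : ∀ ω, U 0 ω = y)
    (hU : (latticeLangevinDynamics (fundamentalLatticeRep 2) β').IsSolution (fundamentalRep (Fin 2)) hW.natFiltration P W U)
    (Ω' : Type) [MeasurableSpace Ω'] (P' : Measure Ω') [IsProbabilityMeasure P']
    (W' : ℝ≥0 → Ω' → (Edge 3 L × NoiseIdx 2 → ℝ)) (hW' : IsFlatBrownian W' P')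
    (U' : ℝ≥0 → Ω' → (GaugeConfig 3 L (Matrix.specialUnitaryGroup (Fin 2) ℂ))) (hU0' : ∀ ω, U' 0 ω = y')
    (hU' : (latticeLangevinDynamics (fundamentalLatticeRep 2) β').IsSolution (fundamentalRep (Fin 2)) hW'.natFiltration P' W' U') :
    |∫ ω, F (U t ω) ∂P - ∫ ω, F (U' t ω) ∂P'| ≤
      12 * Real.sqrt 2 * Real.exp ((|β'| * (4 + 4 * Real.sqrt 2 + 12 * 108)) * (t : ℝ)) * ((2 : ℝ)⁻¹) ^ (R + 1) * ∑ e : Edge 3 L, ℓ e := by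
  classical
  haveI := secondCountableTopology_su2
  haveI := borelSpace_config L
  obtain ⟨κ, hκ, -, hreal⟩ := exists_transitionKernel L β'
  haveI := hκ
  have h := transitionKernel_lightCone L β' κ hreal hFc hℓ hF Λ hℓΛ t R y y' hyy'
  have hlaw : κ t y = P.map (U t) := hreal t y Ω P W hW U hU0 hU
  have hlaw' : κ t y' = P'.map (U' t) := hreal t y' Ω' P' W' hW' U' hU0' hU'
  have hmU : Measurable (U t) := (hU.adapted t).mono (hW.natFiltration.le t) le_rfl
  have hmU' : Measurable (U' t) := (hU'.adapted t).mono (hW'.natFiltration.le t) le_rfl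
  have hFm : Measurable F := hFc.measurable
  have e1 : ∫ z, F z ∂(κ t y) = ∫ ω, F (U t ω) ∂P := by
    rw [hlaw, integral_map hmU.aemeasurable hFm.aestronglyMeasurable]
  have e2 : ∫ z, F z ∂(κ t y') = ∫ ω, F (U' t ω) ∂P' := by
    rw [hlaw', integral_map hmU'.aemeasurable hFm.aestronglyMeasurable]
  rw [← e1, ← e2]
  exact h

end Summit.QuantumFields.YangMills.Theorems.ColdStartUniversality.LiebRobinson
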